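import Summits.AtomisticToContinuum.BoseEinsteinCondensation.Theorems.BoxLatticeFSumKernels
import HarnessLib

/-!
# `BoxLatticeFSum` MC kernel (ii): a super-block mode is the average of its eight child block modes
# (decomp-a2c · hand-1 g9)

For an EVEN block number `K`, block side `ℓ = L/K` and a super-block index `m : SubIdx (K/2+1)` (the index
type of `pieceMode`), ON THE CELL `[0,L)³`:
`subMode (2ℓ) m x = 8^{-1/2} · Σ_{B : SubIdx K, ⌊B_j/2⌋ = m_j ∀ j} subMode ℓ B x`
(`subMode_double_eq_sum_children`); boundary super-blocks (`m_j = K/2` for some `j`) have no children and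
their mode vanishes on the cell.  This is the geometric half of MC's step
«`Σ_B n(u_B) ≥ Σ_m n(pieceMode 0 m)` by Cauchy–Schwarz»; the analytic half (CS on the slice amplitudes and the
fibrewise sum over parents) is left to the MC prover.  No definitions, no `sorry`. [folklore]
-/

noncomputable section

open MeasureTheory Finset
open scoped BigOperators ENNReal

namespace Summit.AtomisticToContinuum.BoseEinsteinCondensation.Theorems.BoxLatticeFSum

open Literature.MathematicalPhysics.QuantumManyBody.BoseGas

/-- `√((2ℓ)³) = √8 · √(ℓ³)` as an identity of inverses in `ℂ`. [folklore] -/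
theorem inv_sqrt_double_cube (ℓ : ℝ) :
    ((Real.sqrt ((2 * ℓ) ^ 3))⁻¹ : ℂ) = ((Real.sqrt 8)⁻¹ : ℂ) * ((Real.sqrt (ℓ ^ 3))⁻¹ : ℂ) := by
  have h : Real.sqrt ((2 * ℓ) ^ 3) = Real.sqrt 8 * Real.sqrt (ℓ ^ 3) := by
    rw [← Real.sqrt_mul (by norm_num : (0 : ℝ) ≤ 8)]; congr 1; ring
  rw [show ((Real.sqrt ((2 * ℓ) ^ 3))⁻¹ : ℂ) = (((Real.sqrt ((2 * ℓ) ^ 3))⁻¹ : ℝ) : ℂ) by push_cast; rfl, h]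
  push_cast
  rw [mul_inv]

/-- A fine block `B` (side `ℓ`) whose index halves to `m` lies inside the super-block `m` (side `2ℓ`).
[folklore] -/
theorem subCell_subset_subCell_double {K K' : ℕ} {ℓ : ℝ} (hℓ : 0 < ℓ) {B : SubIdx K} {m : SubIdx K'}
    (hB : ∀ j : Fin 3, (B j : ℕ) / 2 = (m j : ℕ)) : subCell ℓ B ⊆ subCell (2 * ℓ) m := by
  intro x hx
  rw [mem_subCell] at hx ⊢
  intro i
  have h1 := hx i
  have hdiv := hB i
  have hlo : 2 * (m i : ℕ) ≤ (B i : ℕ) := by omega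
  have hhi : (B i : ℕ) ≤ 2 * (m i : ℕ) + 1 := by omega
  have hlo' : (2 : ℝ) * ((m i : ℕ) : ℝ) ≤ ((B i : ℕ) : ℝ) := by exact_mod_cast hlo
  have hhi' : ((B i : ℕ) : ℝ) ≤ 2 * ((m i : ℕ) : ℝ) + 1 := by exact_mod_cast hhi
  constructor <;> nlinarith [h1.1, h1.2]

/-- Conversely: if `x` lies in the fine block `B` and in the super-block `m`, then `B` is a child of `m`.
[folklore] -/
theorem child_of_mem {K K' : ℕ} {ℓ : ℝ} (hℓ : 0 < ℓ) {B : SubIdx K} {m : SubIdx K'} {x : Space}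
    (hxB : x ∈ subCell ℓ B) (hxm : x ∈ subCell (2 * ℓ) m) : ∀ j : Fin 3, (B j : ℕ) / 2 = (m j : ℕ) := by
  intro j
  rw [mem_subCell] at hxB hxm
  obtain ⟨h1, h2⟩ := hxB j
  obtain ⟨h3, h4⟩ := hxm j
  -- `ℓ B_j ≤ x_j < 2ℓ(m_j+1)` and `2ℓ m_j ≤ x_j < ℓ(B_j+1)`
  have hlt : ((B j : ℕ) : ℝ) < 2 * ((m j : ℕ) : ℝ) + 2 := by nlinarith
  have hgt : 2 * ((m j : ℕ) : ℝ) < ((B j : ℕ) : ℝ) + 1 := by nlinarith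
  have hlt' : (B j : ℕ) < 2 * (m j : ℕ) + 2 := by exact_mod_cast hlt
  have hgt' : 2 * (m j : ℕ) < (B j : ℕ) + 1 := by exact_mod_cast hgt
  omega

/-- **A super-block mode is `8^{-1/2}` times the sum of its child block modes, on the cell.**  For `K > 0`
even... (evenness is not even needed: children are the fine blocks `B : SubIdx K` with `⌊B_j/2⌋ = m_j`),
`ℓ = L/K`, `m : SubIdx (K/2+1)` and `x ∈ [0,L)³`:
`subMode (2ℓ) m x = (√8)⁻¹ · Σ_{B child of m} subMode ℓ B x`. [folklore] -/
theorem subMode_double_eq_sum_children {K : ℕ} {L : ℝ} (hK : 0 < K) (hL : 0 < L) (m : SubIdx (K / 2 + 1))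
    (x : Space) (hx : x ∈ cell L) :
    subMode (2 * (L / (K : ℝ))) m x = ((Real.sqrt 8)⁻¹ : ℂ) *
      ∑ B ∈ (Finset.univ : Finset (SubIdx K)).filter (fun B => ∀ j : Fin 3, (B j : ℕ) / 2 = (m j : ℕ)),
        subMode (L / (K : ℝ)) B x := by
  classical
  have hKr : (0 : ℝ) < K := by exact_mod_cast hK
  set ℓ : ℝ := L / (K : ℝ) with hℓ_def
  have hℓ : 0 < ℓ := div_pos hL hKr
  have hxK : x ∈ cell (K * ℓ) := by rwa [hℓ_def, mul_div_cancel₀ L hKr.ne']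
  -- the fine block containing `x`
  obtain ⟨B₀, hB₀⟩ := exists_mem_subCell hℓ hxK
  simp_rw [subMode_eq_indicator]
  by_cases hxm : x ∈ subCell (2 * ℓ) m
  · -- `B₀` is a child of `m`, and the only child containing `x`
    have hchild : ∀ j : Fin 3, (B₀ j : ℕ) / 2 = (m j : ℕ) := child_of_mem hℓ hB₀ hxm
    rw [Set.indicator_of_mem hxm, Finset.sum_eq_single B₀]
    · rw [Set.indicator_of_mem hB₀, inv_sqrt_double_cube ℓ]
    · intro B hB hne
      exact Set.indicator_of_notMem (not_mem_subCell_of_ne hℓ (Ne.symm hne) hB₀) _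
    · intro h
      exact absurd (Finset.mem_filter.2 ⟨Finset.mem_univ _, hchild⟩) h
  · -- no child of `m` contains `x`
    rw [Set.indicator_of_notMem hxm]
    symm
    rw [mul_eq_zero]; right
    refine Finset.sum_eq_zero fun B hB => ?_
    rw [Finset.mem_filter] at hB
    exact Set.indicator_of_notMem (fun h => hxm (subCell_subset_subCell_double hℓ hB.2 h)) _

/-- `pieceMode` at the zero shift is the super-block mode. [folklore] -/
theorem pieceMode_zero_shift {K : ℕ} (L : ℝ) (m : SubIdx (K / 2 + 1)) :
    pieceMode L K (fun _ => (⟨0, two_pos⟩ : Fin 2)) m = subMode (2 * (L / (K : ℝ))) m := by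
  funext x
  unfold pieceMode blockShift
  congr 1
  have h0 : (WithLp.toLp 2 fun i : Fin 3 => L / (K : ℝ) * (((((fun _ : Fin 3 => (⟨0, two_pos⟩ : Fin 2)) i : Fin 2)) : ℕ) : ℝ)) =
      (0 : Space) := by
    ext i; simp
  rw [h0, add_zero]

end Summit.AtomisticToContinuum.BoseEinsteinCondensation.Theorems.BoxLatticeFSum

end
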